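import Summits.ABC.ABC.Theses.RibetTakahashiSplit
import Literature.NumberTheory.EllipticCurves.SzpiroLocalDataProofs
import Literature.NumberTheory.EllipticCurves.SzpiroBGEquivalenceProofs
import Literature.NumberTheory.DiophantineGeometry.MinimalDiscriminantSmulProofs
import Literature.NumberTheory.DiophantineGeometry.MinimalDiscriminantFiniteProofs
import Literature.NumberTheory.DiophantineGeometry.MinimalDiscriminantProofs
import Literature.NumberTheory.Sieve.DivisorBound

/-!
# Disproof of `WeightedSzpiroBound` (crux stmt-ABC-3272, route ABC/RibetTakahashiSplit, rank 3) — findings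

Standing adversary file (refuter seat `refuter-cdisprove-stmt-ABC-3272-0`, opened 2026-08-15).
Sorry-free, `lean check` rc 0; every theorem below is machine-checked.

**The crux.** `∀ ε > 0 ∃ C ∀ W₀ : WeierstrassCurve ℤ`, elliptic over `ℚ`, minimal at every prime,
semistable away from `2` (`p² ∤ N` for odd `p`):
`max (|Δ(W₀)|, |c₄(W₀)|³) ≤ C · (N · T)^{6+ε}`, `N = conductorNorm`, `T = ∏_{p ∣ N, p² ∤ N} ord_p Δ_min`
(`minimalDiscriminantNorm.factorization`). Readback of the elaborated term: all objects are the
Mathlib/H21 definitions (`IsMinimal` over `O_v`, Ogg-formula conductor via Tate's algorithm,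
`Ideal.absNorm` of `finprod`s); `^` is `Real.rpow` on a cast `ℕ`-product; no junk operator bites an
ELLIPTIC `W₀` (for elliptic `W`, `N ≥ 1`, `|Δ_min| ≥ 1`, `T ≥ 1` — `one_le_weight`).

## Findings (section numbers = sections of this file)

0. **Why it resists — machine-checked.** `GeneralizedSzpiroConjectureBG → WeightedSzpiroBound`
   (`weightedSzpiroBound_of_generalizedSzpiroBG`, via `T ≥ 1`) and `ABC → WeightedSzpiroBound`
   (`weightedSzpiroBound_of_abc`, via the tree's `abcLe_iff_generalizedSzpiroBG_holds`, B–G Thm.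
   12.5.12). Hence `¬ WeightedSzpiroBound → ¬ ABC` (`not_abc_of_not_weightedSzpiroBound`): there is
   NO refutation of this crux short of a disproof of the abc conjecture; no counterexample search can
   succeed unless abc fails. Conversely the crux restricted to curves with `≤ B` odd multiplicative
   primes is Szpiro-up-to-polylog for those curves (`T ≤ (log|Δ_min|)^{ω(N)}`), open for every `B ≥ 2`
   (Pillai regime) — it is genuinely abc-strength, as the route itself says.
1. **`IsElliptic` is load-bearing**: `¬ WeightedSzpiroBoundWithoutIsElliptic`
   (`weightedSzpiroBound_false_without_isElliptic`; nodal cubics `y² = (x−k)²(x+2k)`: `Δ = 0`,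
   `c₄ = 144k²`, junk `N = 1`, `T = 1`, every integral model minimal).
2. **Minimality is load-bearing**: `¬ WeightedSzpiroBoundWithoutMinimality`
   (`weightedSzpiroBound_false_without_minimality`; `y² = x³ − k⁴x ≅ y² = x³ − x`: `N ∣ 64`, `T ≤ 6`,
   `Δ = 64k¹²`). Any proof must use `IsMinimalAt` at the primes dividing `k`-type rescalings, i.e.
   must control `max(|Δ|,|c₄|³)` through the MINIMAL discriminant, not through the model.
3. **"Semistable away from 2" is NOT load-bearing for truth**: the statement without it is still a
   consequence of `GeneralizedSzpiroConjectureBG` / `ABC` (`withoutSemistability_of_abc`). It is a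
   mechanism hypothesis (Ribet–Takahashi needs multiplicative primes), possibly unnecessary for a
   proof by other means; a proof not using it proves weighted generalized Szpiro for all `E/ℚ`.
4. **Natural strengthening `ε = 0`** (`WeightedSzpiroBoundEpsZero`, implies the crux:
   `weightedSzpiroBound_of_epsZero`): OPEN. Masser's barrier (`SzpiroEpsilonCannotBeDropped`, proved in
   tree) does NOT transfer: on Masser/Stewart–Tijdeman families `log T ≍ √(log N)` swamps the excess
   `(24−δ)√(log N)/log log N` (for `log log N > 4`); Bennett–Yazdani's exponent-6 twists are absorbed
   by `T ≥ 6^{ω}`. A refutation needs high prime powers beating the radical cost of all low-exponent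
   primes (cube-full Pillai/Hall-type families), unknown; plausibly the `ε = 0` form is even TRUE.
5. **Tightness — the exponent `6` is sharp even with the weight**: for every `κ < 6`,
   `¬ WeightedSzpiroBoundExp κ` (`weightedSzpiroBoundExp_false_of_lt_six`; the crux is
   `∀ ε > 0, WeightedSzpiroBoundExp (6 + ε)`). Witness family: the global minimal Frey models
   `tightModel n = freyIntModel₂ (−1) 2ⁿ` of `1 + (2ⁿ − 1) = 2ⁿ` (`|c₄|³ ≥ 2^{6n}/8`, `N ≤ 2^{n+1}`,
   `T ≤ τ(|Δ_min|) ≤ C_η 2^{4nη}` by the tree's divisor bound). So the weight `T(E)` buys at most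
   `N^{o(1)}`: the crux is Szpiro-sharp from below and abc-hard from above.
6. **Computation.** (a) By the explicit Frey formulas (exact away from `2`; `f₂` by Tate's steps 1–4
   where `2 ∥ abc`), the seven champion abc triples give generalized-Szpiro ratio
   `σ = log max(|Δ_min|, c₄³)/log N ∈ [7.2, 9.76]` but WEIGHTED ratio
   `γ = log max(|Δ_min|, c₄³)/log(N·T)` only `∈ [4.3, 5.95]` (max `5.95` at
   `19·1307 + 7·29²·31⁸ = 2⁸·3²²·5⁴`, `T = 1441792`; Reyssat's `2 + 3¹⁰·109 = 23⁵`: `σ = 8.26`, `γ = 5.57`,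
   `f₂ = 5`, type III): on the known extremal data the weight alone brings the ratio below `6`, i.e. even
   `C = 1, ε = 0` is not violated there (single curves could only ever bound `C(ε)` anyway).
   (b) Two kit jobs extend this: j006098 = census of `γ`/`σ` over Frey curves of all coprime pairs of
   13-smooth numbers `≤ 10⁸` (1.2·10⁸ pairs, exact recomputation of the top 150 by PARI), j006099 = the
   route's mechanism falsifier `r(E) = log(deg φ/T)/log N` (PARI `ellmoddegree`) over Frey curves with
   `N ≤ 6000`. Both were still queued (priority starvation, > 6 h) when this cycle closed; their
   summaries attach to item stmt-ABC-3272 automatically when they run (scripts: seat folder `census/`).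
7. **Strength certificate — the crux ALONE is abc-hard in the few-prime regime**:
   `WeightedSzpiroBound → SzpiroFewBadPrimes B` for every `B` (generalized Szpiro for curves
   semistable away from 2 with `≤ B` bad primes; `szpiroFewBadPrimes_of_weightedSzpiroBound`, because
   unconditionally `T ≤ (log₂|Δ_min|)^{ω(N)}`, absorbed by `M^θ`), hence
   `WeightedSzpiroBound → AbcBoundedOmega B` (abc for `ω(abc) ≤ B`, the Pillai/Catalan regime — OPEN
   for `B ≥ 3`; `abcBoundedOmega_of_weightedSzpiroBound`). So r3′ is not softened by the weight where
   `ω` is bounded: its only slack is the many-prime regime (`T` up to `N^{o(1)}`), exactly where the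
   route's own r2 lives. Sandwich, all machine-checked:
   `ABC ⟹ GeneralizedSzpiroBG ⟹ WeightedSzpiroBound ⟹ (∀ B, AbcBoundedOmega B)`.

## For provers / planners
* Nothing here weakens the crux; items 1–2 say which hypotheses any proof must touch, item 3 which
  one it may ignore, item 0 that the refuter has no further truth-level attack (the seat continues on
  strengthenings and on the mechanism-level falsifier of the route: the `ξ_f ≤ N^{2+ε}` census).
* Negative knowledge in this file (the gate lets refuters land only `¬ <Theses decl>` theorems, so
  these travel as item evidence, not as tree files): `weightedSzpiroBound_false_without_isElliptic`,
  `weightedSzpiroBound_false_without_minimality`, `weightedSzpiroBoundExp_false_of_lt_six`.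
-/

namespace Summit.ABC.ABC.Cruxes.WeightedSzpiroBound.Disproof

open WeierstrassCurve IsDedekindDomain
open Summit.ABC.ABC.Theses.RibetTakahashiSplit
open Literature.NumberTheory.EllipticCurves

/-! ## 0. The weight factor `T(E) ≥ 1` and the reduction crux ⟸ generalized Szpiro ⟸ ABC -/

/-- `T(E) = ∏_{p ∣ N, p² ∤ N} ord_p (Δ_min) ≥ 1` for an elliptic curve over `ℚ`: every prime of the
conductor divides the minimal discriminant (`N ∣ |Δ_min|`). [folklore] -/
theorem one_le_weight (W : WeierstrassCurve ℚ) [W.IsElliptic] :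
    1 ≤ ∏ p ∈ (W.conductorNorm ℤ).primeFactors with ¬ p ^ 2 ∣ W.conductorNorm ℤ,
      (W.minimalDiscriminantNorm ℤ).factorization p := by
  rw [Nat.one_le_iff_ne_zero, Finset.prod_ne_zero_iff]
  intro p hp
  rw [Finset.mem_filter, Nat.mem_primeFactors] at hp
  obtain ⟨⟨hprime, hdvd, -⟩, -⟩ := hp
  have hD : W.conductorNorm ℤ ∣ W.minimalDiscriminantNorm ℤ :=
    conductorNorm_dvd_minimalDiscriminantNorm W
      (finite_setOf_ordMinimalDiscriminant_ne_zero_holds (A := ℤ) W)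
  exact (hprime.factorization_pos_of_dvd (minimalDiscriminantNorm_pos_holds W).ne'
    (hdvd.trans hD)).ne'

/-- The crux follows from the generalized Szpiro conjecture of Bombieri–Gubler (Conj. 12.5.11,
`GeneralizedSzpiroConjectureBG`): the weighted conductor `N · T(E)` is at least `N`. [folklore] -/
theorem weightedSzpiroBound_of_generalizedSzpiroBG (h : GeneralizedSzpiroConjectureBG) :
    WeightedSzpiroBound := by
  intro ε hε
  obtain ⟨C, hC⟩ := h ε hε
  refine ⟨max C 0, fun W₀ hE hmin _ ↦ ?_⟩
  haveI := hE
  have key := hC W₀ hE hmin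
  have hN : (0 : ℝ) ≤ (((W₀.baseChange ℚ).conductorNorm ℤ : ℕ) : ℝ) := by positivity
  have hT : (1 : ℝ) ≤ ((∏ p ∈ ((W₀.baseChange ℚ).conductorNorm ℤ).primeFactors with
      ¬ p ^ 2 ∣ (W₀.baseChange ℚ).conductorNorm ℤ,
        ((W₀.baseChange ℚ).minimalDiscriminantNorm ℤ).factorization p : ℕ) : ℝ) := by
    exact_mod_cast one_le_weight (W₀.baseChange ℚ)
  calc _ ≤ C * (((W₀.baseChange ℚ).conductorNorm ℤ : ℕ) : ℝ) ^ (6 + ε) := key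
    _ ≤ max C 0 * (((W₀.baseChange ℚ).conductorNorm ℤ : ℕ) : ℝ) ^ (6 + ε) :=
        mul_le_mul_of_nonneg_right (le_max_left _ _) (Real.rpow_nonneg hN _)
    _ ≤ _ := mul_le_mul_of_nonneg_left
        (Real.rpow_le_rpow hN (le_mul_of_one_le_right hN hT) (by linarith)) (le_max_right _ _)

/-- The crux follows from the abc conjecture (summit statement `ABC`), through
`abcLe_iff_generalizedSzpiroBG_holds` (Bombieri–Gubler Thm. 12.5.12, proved in the tree).
Consequently **any disproof of the crux is a disproof of `ABC`**. [folklore] -/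
theorem weightedSzpiroBound_of_abc (h : _root_.ABC) : WeightedSzpiroBound := by
  refine weightedSzpiroBound_of_generalizedSzpiroBG (abcLe_iff_generalizedSzpiroBG_holds.mp ?_)
  intro ε hε
  obtain ⟨C, -, hC⟩ := h ε hε
  exact ⟨C, fun a b c ht ↦ (hC a b c ht).le⟩

/-- Contrapositive form used by the refuter: `¬ WeightedSzpiroBound → ¬ ABC`. [folklore] -/
theorem not_abc_of_not_weightedSzpiroBound (h : ¬ WeightedSzpiroBound) : ¬ _root_.ABC :=
  fun hA ↦ h (weightedSzpiroBound_of_abc hA)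


/-! ## 1. Load-bearing hypothesis: ellipticity (`Δ ≠ 0`)

Dropping `(W₀.baseChange ℚ).IsElliptic` makes the statement FALSE: for a singular integral
equation every integral model is minimal (Mathlib's `IsMinimal` maximises `|Δ|ᵥ`, and `Δ = 0`
throughout the isomorphism class), the conductor and the weight are the junk values `N = 1`,
`T = 1` (empty product), so the bound reads `|c₄|³ ≤ C`, while the nodal cubics
`y² = x³ − 3k²x + 2k³ = (x − k)²(x + 2k)` have `c₄ = 144 k²`. -/

/-- The crux with the hypothesis `(W₀.baseChange ℚ).IsElliptic` removed (everything else verbatim). -/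
def WeightedSzpiroBoundWithoutIsElliptic : Prop :=
  ∀ ε : ℝ, 0 < ε → ∃ C : ℝ, ∀ W₀ : WeierstrassCurve ℤ,
    (∀ v : HeightOneSpectrum ℤ, (W₀.baseChange ℚ).IsMinimalAt v) →
    (∀ p : ℕ, p.Prime → p ≠ 2 → ¬ p ^ 2 ∣ (W₀.baseChange ℚ).conductorNorm ℤ) →
    ((max |W₀.Δ| (|W₀.c₄| ^ 3) : ℤ) : ℝ) ≤ C * ((((W₀.baseChange ℚ).conductorNorm ℤ : ℕ) : ℝ) *
      ((∏ p ∈ ((W₀.baseChange ℚ).conductorNorm ℤ).primeFactors with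
        ¬ p ^ 2 ∣ (W₀.baseChange ℚ).conductorNorm ℤ,
        ((W₀.baseChange ℚ).minimalDiscriminantNorm ℤ).factorization p : ℕ) : ℝ)) ^ (6 + ε)

/-- Sanity: the crux is its elliptic restriction. [folklore] -/
theorem weightedSzpiroBound_of_withoutIsElliptic (h : WeightedSzpiroBoundWithoutIsElliptic) :
    WeightedSzpiroBound :=
  fun ε hε ↦ (h ε hε).imp fun _ hC W₀ _ hmin hss ↦ hC W₀ hmin hss

/-- The nodal cubic `y² = x³ − 3k²x + 2k³ = (x − k)²(x + 2k)` over `ℤ`. -/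
def nodalModel (k : ℤ) : WeierstrassCurve ℤ := ⟨0, 0, 0, -3 * k ^ 2, 2 * k ^ 3⟩

/-- `Δ = 0` for the nodal cubic. [folklore] -/
theorem nodalModel_Δ (k : ℤ) : (nodalModel k).Δ = 0 := by
  simp only [nodalModel, WeierstrassCurve.Δ, WeierstrassCurve.b₂, WeierstrassCurve.b₄,
    WeierstrassCurve.b₆, WeierstrassCurve.b₈]
  ring

/-- `c₄ = 144 k²` for the nodal cubic. [folklore] -/
theorem nodalModel_c₄ (k : ℤ) : (nodalModel k).c₄ = 144 * k ^ 2 := by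
  simp only [nodalModel, WeierstrassCurve.c₄, WeierstrassCurve.b₂, WeierstrassCurve.b₄]
  ring

section Singular

variable {A : Type*} [CommRing A] [IsDedekindDomain A] {K : Type*} [Field K]
  [Algebra A K] [IsFractionRing A K]

/-- Junk value (documented on `WeierstrassCurve.ordMinimalDiscriminant`): for a singular `W`
(`Δ = 0`) every exponent `ord_v (Δ_min)` is `0` — the integral local minimal model has `Δ = 0`
(`Δ` transforms by `u⁻¹²`), `addVal 0 = ⊤`, `⊤.toNat = 0`. (Public copy of the private lemma of
`MinimalDiscriminantFactorizationProofs`.) [folklore] -/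
theorem ordMinimalDiscriminant_eq_zero_of_Δ_eq_zero (W : WeierstrassCurve K) (hW : W.Δ = 0)
    (v : HeightOneSpectrum A) : W.ordMinimalDiscriminant v = 0 := by
  have h0 : (((W.baseChange (v.adicCompletion K)).minimal (v.adicCompletionIntegers K)).integralModel
      (v.adicCompletionIntegers K)).Δ = 0 := by
    apply FaithfulSMul.algebraMap_injective (v.adicCompletionIntegers K) (v.adicCompletion K)
    rw [integralModel_Δ_eq, map_zero, minimal, variableChange_Δ, baseChange, map_Δ, hW, map_zero,
      mul_zero]
  change (IsDiscreteValuationRing.addVal _ ((((W.baseChange (v.adicCompletion K)).minimal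
    (v.adicCompletionIntegers K)).integralModel (v.adicCompletionIntegers K)).Δ)).toNat = 0
  rw [h0, IsDiscreteValuationRing.addVal_zero, ENat.toNat_top]

/-- Junk value: for a singular `W` every conductor exponent `f_v = ord_v (Δ_min) + 1 − m_v` is `0`
(`ord_v (Δ_min) = 0` and every Kodaira symbol has `m_v ≥ 1` components). [folklore] -/
theorem conductorExponent_eq_zero_of_Δ_eq_zero (W : WeierstrassCurve K) (hW : W.Δ = 0)
    (v : HeightOneSpectrum A) : W.conductorExponent v = 0 := by
  have h1 := (W.kodairaSymbolAt v).numComponents_pos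
  unfold conductorExponent numComponentsAt
  rw [ordMinimalDiscriminant_eq_zero_of_Δ_eq_zero W hW v]
  omega

/-- Junk value: the conductor ideal of a singular `W` is `1 = ⊤`. [folklore] -/
theorem conductor_eq_one_of_Δ_eq_zero (W : WeierstrassCurve K) (hW : W.Δ = 0) :
    W.conductor A = 1 := by
  unfold WeierstrassCurve.conductor
  simp only [conductorExponent_eq_zero_of_Δ_eq_zero W hW, pow_zero, finprod_one]

/-- Junk value: the conductor `N` of a singular `W / ℚ` is `1`. [folklore] -/
theorem conductorNorm_eq_one_of_Δ_eq_zero (W : WeierstrassCurve ℚ) (hW : W.Δ = 0) :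
    W.conductorNorm ℤ = 1 := by
  unfold conductorNorm
  rw [conductor_eq_one_of_Δ_eq_zero W hW, Ideal.one_eq_top, Ideal.absNorm_top]

/-- A singular integral equation over `ℤ` is minimal at every prime (vacuously: `Δ = 0` for every
model in its isomorphism class). [folklore] -/
theorem isMinimalAt_baseChange_int_of_Δ_eq_zero (W₀ : WeierstrassCurve ℤ) (hΔ : W₀.Δ = 0)
    (v : HeightOneSpectrum ℤ) : (W₀.baseChange ℚ).IsMinimalAt v := by
  rw [IsMinimalAt,
    isMinimal_iff_of_le_one_iff (valued_le_one_iff_mem_range_adicCompletionIntegers v)]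
  refine ⟨isIntegralAt_baseChange_int v W₀, fun C _ ↦ ?_⟩
  have h0 : ((W₀.baseChange ℚ).baseChange (v.adicCompletion ℚ)).Δ = 0 := by
    rw [baseChange, map_Δ, baseChange_int_Δ, hΔ, Int.cast_zero, map_zero]
  rw [variableChange_Δ, h0, mul_zero]

end Singular

/-- **Any proof of the crux must use ellipticity**: the crux with `IsElliptic` dropped is false.
Witness: the nodal cubics `nodalModel k` (`Δ = 0`, `c₄ = 144k²`, junk `N = T = 1`), at `ε = 1`,
`k = ⌈C⌉₊ + 1`. [folklore] -/
theorem weightedSzpiroBound_false_without_isElliptic : ¬ WeightedSzpiroBoundWithoutIsElliptic := by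
  intro h
  obtain ⟨C, hC⟩ := h 1 one_pos
  set k : ℕ := ⌈C⌉₊ + 1 with hk
  have hkC : C < k := by
    have := Nat.le_ceil C
    push_cast [hk]
    linarith
  have hk1 : (1 : ℝ) ≤ k := by exact_mod_cast Nat.succ_le_succ (Nat.zero_le _)
  have hΔ : (nodalModel k).Δ = 0 := nodalModel_Δ k
  have hΔ' : ((nodalModel k).baseChange ℚ).Δ = 0 := by rw [baseChange_int_Δ, hΔ, Int.cast_zero]
  have hN : ((nodalModel k).baseChange ℚ).conductorNorm ℤ = 1 :=
    conductorNorm_eq_one_of_Δ_eq_zero _ hΔ'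
  have key := hC (nodalModel k) (isMinimalAt_baseChange_int_of_Δ_eq_zero _ hΔ) (by
    intro p hp _ hdvd
    have h1 : p ^ 2 ≤ 1 := Nat.le_of_dvd one_pos (hN ▸ hdvd)
    have h2 := hp.two_le
    nlinarith)
  rw [hN, hΔ, nodalModel_c₄] at key
  simp only [Nat.primeFactors_one, Finset.filter_empty, Finset.prod_empty, Nat.cast_one, mul_one,
    Real.one_rpow] at key
  push_cast at key
  have hx : (k : ℝ) ≤ 144 * (k : ℝ) ^ 2 := by nlinarith
  have hy : 144 * (k : ℝ) ^ 2 ≤ (144 * (k : ℝ) ^ 2) ^ 3 := le_self_pow₀ (by nlinarith) (by norm_num)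
  have hz : (144 * (k : ℝ) ^ 2) ^ 3 ≤ max |(0 : ℝ)| (|144 * (k : ℝ) ^ 2| ^ 3) :=
    le_max_of_le_right (by rw [abs_of_nonneg (by positivity)])
  linarith


/-! ## 2. Load-bearing hypothesis: minimality of the integral model at every prime

Dropping `∀ v, (W₀.baseChange ℚ).IsMinimalAt v` makes the statement FALSE: `N` and `T` are
isomorphism invariants of `E / ℚ` but `max (|Δ|, |c₄|³)` of a non-minimal integral model is not
bounded in terms of `E` — rescale `y² = x³ − x` (`Δ = 64`, `N ∣ 64`) to `y² = x³ − k⁴ x`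
(`Δ = 64 k¹²`). -/

/-- The crux with the minimality hypothesis removed (everything else verbatim). -/
def WeightedSzpiroBoundWithoutMinimality : Prop :=
  ∀ ε : ℝ, 0 < ε → ∃ C : ℝ, ∀ W₀ : WeierstrassCurve ℤ, (W₀.baseChange ℚ).IsElliptic →
    (∀ p : ℕ, p.Prime → p ≠ 2 → ¬ p ^ 2 ∣ (W₀.baseChange ℚ).conductorNorm ℤ) →
    ((max |W₀.Δ| (|W₀.c₄| ^ 3) : ℤ) : ℝ) ≤ C * ((((W₀.baseChange ℚ).conductorNorm ℤ : ℕ) : ℝ) *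
      ((∏ p ∈ ((W₀.baseChange ℚ).conductorNorm ℤ).primeFactors with
        ¬ p ^ 2 ∣ (W₀.baseChange ℚ).conductorNorm ℤ,
        ((W₀.baseChange ℚ).minimalDiscriminantNorm ℤ).factorization p : ℕ) : ℝ)) ^ (6 + ε)

/-- Sanity: the crux is the restriction to global minimal models. [folklore] -/
theorem weightedSzpiroBound_of_withoutMinimality (h : WeightedSzpiroBoundWithoutMinimality) :
    WeightedSzpiroBound :=
  fun ε hε ↦ (h ε hε).imp fun _ hC W₀ hE _ hss ↦ hC W₀ hE hss

/-- The global minimal model `y² = x³ − x` (Cremona 32a2; `Δ = 64`, `c₄ = 48`). -/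
def baseModel : WeierstrassCurve ℤ := ⟨0, 0, 0, -1, 0⟩

/-- The rescaled, non-minimal models `y² = x³ − k⁴ x` of the same curve (`k ≠ 0`). -/
def rescaledModel (k : ℤ) : WeierstrassCurve ℤ := ⟨0, 0, 0, -k ^ 4, 0⟩

/-- `Δ (y² = x³ − x) = 64`. [folklore] -/
theorem baseModel_Δ : baseModel.Δ = 64 := by
  simp only [baseModel, WeierstrassCurve.Δ, WeierstrassCurve.b₂, WeierstrassCurve.b₄,
    WeierstrassCurve.b₆, WeierstrassCurve.b₈]
  norm_num

/-- `Δ (y² = x³ − k⁴x) = 64 k¹²`. [folklore] -/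
theorem rescaledModel_Δ (k : ℤ) : (rescaledModel k).Δ = 64 * k ^ 12 := by
  simp only [rescaledModel, WeierstrassCurve.Δ, WeierstrassCurve.b₂, WeierstrassCurve.b₄,
    WeierstrassCurve.b₆, WeierstrassCurve.b₈]
  ring

/-- Over `ℚ`, `y² = x³ − k⁴x` is the change of variables `u = k⁻¹` of `y² = x³ − x`. [folklore] -/
theorem rescaledModel_baseChange_eq_smul (k : ℤ) (hk : k ≠ 0) :
    (rescaledModel k).baseChange ℚ =
      (⟨(Units.mk0 (k : ℚ) (by exact_mod_cast hk))⁻¹, 0, 0, 0⟩ : VariableChange ℚ) •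
        baseModel.baseChange ℚ := by
  ext <;> simp [rescaledModel, baseModel, baseChange, variableChange_def]

/-- `y² = x³ − x` over `ℤ` is minimal at every prime (`ord_p (Δ) = ord_p (64) < 12`). [folklore] -/
theorem isMinimalAt_baseModel (v : HeightOneSpectrum ℤ) : (baseModel.baseChange ℚ).IsMinimalAt v := by
  refine isMinimalAt_baseChange_int_of_not_pow_dvd_Δ fun h ↦ ?_
  rw [baseModel_Δ] at h
  have hp := (Rat.HeightOneSpectrum.prime_natGenerator v).two_le
  have h64 : ((Rat.HeightOneSpectrum.natGenerator v : ℤ)) ^ 12 ≤ 64 := Int.le_of_dvd (by norm_num) h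
  have h4 : (2 : ℤ) ^ 12 ≤ ((Rat.HeightOneSpectrum.natGenerator v : ℤ)) ^ 12 :=
    pow_le_pow_left₀ (by norm_num) (by exact_mod_cast hp) 12
  linarith

/-- The minimal discriminant of the curve `y² = x³ − k⁴x` (`k ≠ 0`) is `|Δ_min| = 64`, whatever
the model. [folklore] -/
theorem minimalDiscriminantNorm_rescaledModel (k : ℤ) (hk : k ≠ 0) :
    ((rescaledModel k).baseChange ℚ).minimalDiscriminantNorm ℤ = 64 := by
  unfold minimalDiscriminantNorm
  rw [rescaledModel_baseChange_eq_smul k hk, minimalDiscriminantIdeal_smul_holds]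
  change (baseModel.baseChange ℚ).minimalDiscriminantNorm ℤ = 64
  rw [minimalDiscriminantNorm_eq_natAbs_holds baseModel (by rw [baseModel_Δ]; norm_num)
    isMinimalAt_baseModel, baseModel_Δ]
  rfl

/-- `y² = x³ − k⁴x` is an elliptic curve over `ℚ` for `k ≠ 0`. [folklore] -/
theorem isElliptic_rescaledModel (k : ℤ) (hk : k ≠ 0) : ((rescaledModel k).baseChange ℚ).IsElliptic := by
  refine ⟨isUnit_iff_ne_zero.mpr ?_⟩
  rw [baseChange_int_Δ, rescaledModel_Δ]
  exact_mod_cast mul_ne_zero (by norm_num) (pow_ne_zero 12 hk)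

/-- The conductor of `y² = x³ − k⁴x` divides `64` (`N ∣ |Δ_min| = 64`; in truth `N = 32`).
[folklore] -/
theorem conductorNorm_rescaledModel_dvd (k : ℤ) (hk : k ≠ 0) :
    ((rescaledModel k).baseChange ℚ).conductorNorm ℤ ∣ 64 := by
  haveI := isElliptic_rescaledModel k hk
  rw [← minimalDiscriminantNorm_rescaledModel k hk]
  exact conductorNorm_dvd_minimalDiscriminantNorm _
    (finite_setOf_ordMinimalDiscriminant_ne_zero_holds (A := ℤ) _)

/-- **Any proof of the crux must use minimality of the model**: the crux with
`∀ v, IsMinimalAt v` dropped is false. Witness: `rescaledModel k` (`N ∣ 64`, `T ≤ 6`,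
`|Δ| = 64 k¹²`), at `ε = 1`. [folklore] -/
theorem weightedSzpiroBound_false_without_minimality : ¬ WeightedSzpiroBoundWithoutMinimality := by
  intro h
  obtain ⟨C, hC⟩ := h 1 one_pos
  -- the constant `B = 384 ^ 7` bounds `(N T) ^ 7`
  set B : ℝ := (384 : ℝ) ^ ((6 : ℝ) + 1) with hB
  have hB0 : 0 ≤ B := by positivity
  set k : ℕ := ⌈max C 0 * B⌉₊ + 1 with hk
  have hk0 : (k : ℤ) ≠ 0 := by
    have : k ≠ 0 := by omega
    exact_mod_cast this
  have hkC : max C 0 * B < k := by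
    have := Nat.le_ceil (max C 0 * B)
    push_cast [hk]
    linarith
  have hk1 : (1 : ℝ) ≤ k := by exact_mod_cast Nat.succ_le_succ (Nat.zero_le _)
  haveI hE := isElliptic_rescaledModel (k : ℤ) hk0
  have hN := conductorNorm_rescaledModel_dvd (k : ℤ) hk0
  have hD := minimalDiscriminantNorm_rescaledModel (k : ℤ) hk0
  -- semistability away from 2 holds: `N ∣ 64`
  have hss : ∀ p : ℕ, p.Prime → p ≠ 2 →
      ¬ p ^ 2 ∣ ((rescaledModel (k : ℤ)).baseChange ℚ).conductorNorm ℤ := by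
    intro p hp hp2 hdvd
    have h1 : p ∣ 2 ^ 6 := (dvd_pow_self p two_ne_zero).trans (hdvd.trans hN)
    exact hp2 ((Nat.prime_dvd_prime_iff_eq hp Nat.prime_two).mp (hp.dvd_of_dvd_pow h1))
  have key := hC (rescaledModel (k : ℤ)) hE hss
  -- abbreviations
  set N : ℕ := ((rescaledModel (k : ℤ)).baseChange ℚ).conductorNorm ℤ with hNdef
  set T : ℕ := ∏ p ∈ N.primeFactors with ¬ p ^ 2 ∣ N,
    (((rescaledModel (k : ℤ)).baseChange ℚ).minimalDiscriminantNorm ℤ).factorization p with hTdef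
  -- `N ≤ 64`
  have hN64 : (N : ℝ) ≤ 64 := by exact_mod_cast Nat.le_of_dvd (by norm_num) hN
  -- `T ≤ 6`
  have hT6 : (T : ℝ) ≤ 6 := by
    have hsub : N.primeFactors.filter (fun p ↦ ¬ p ^ 2 ∣ N) ⊆ {2} := by
      intro p hp
      rw [Finset.mem_filter, Nat.mem_primeFactors] at hp
      obtain ⟨⟨hprime, hpN, -⟩, -⟩ := hp
      have h1 : p ∣ 2 ^ 6 := hpN.trans hN
      rw [Finset.mem_singleton]
      exact (Nat.prime_dvd_prime_iff_eq hprime Nat.prime_two).mp (hprime.dvd_of_dvd_pow h1)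
    have hfac : ∀ p ∈ N.primeFactors.filter (fun p ↦ ¬ p ^ 2 ∣ N),
        (((rescaledModel (k : ℤ)).baseChange ℚ).minimalDiscriminantNorm ℤ).factorization p ≤ 6 := by
      intro p hp
      rw [hD]
      have hp2 : p = 2 := Finset.mem_singleton.mp (hsub hp)
      subst hp2
      exact Nat.factorization_le_of_le_pow (by norm_num)
    have hT' : T ≤ 6 ^ (N.primeFactors.filter (fun p ↦ ¬ p ^ 2 ∣ N)).card :=
      Finset.prod_le_pow_card _ _ 6 hfac
    have hcard : (N.primeFactors.filter (fun p ↦ ¬ p ^ 2 ∣ N)).card ≤ 1 :=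
      (Finset.card_le_card hsub).trans (by simp)
    have h6 : 6 ^ (N.primeFactors.filter (fun p ↦ ¬ p ^ 2 ∣ N)).card ≤ 6 := by
      calc 6 ^ (N.primeFactors.filter (fun p ↦ ¬ p ^ 2 ∣ N)).card ≤ 6 ^ 1 :=
            Nat.pow_le_pow_right (by norm_num) hcard
        _ = 6 := by norm_num
    exact_mod_cast hT'.trans h6
  have hNT : (N : ℝ) * T ≤ 384 := by
    have hN0 : (0 : ℝ) ≤ N := by positivity
    have hT0 : (0 : ℝ) ≤ T := by positivity
    nlinarith
  have hNT0 : (0 : ℝ) ≤ (N : ℝ) * T := by positivity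
  have hpow : ((N : ℝ) * T) ^ ((6 : ℝ) + 1) ≤ B := Real.rpow_le_rpow hNT0 hNT (by norm_num)
  have hR : C * ((N : ℝ) * T) ^ ((6 : ℝ) + 1) ≤ max C 0 * B :=
    (mul_le_mul_of_nonneg_right (le_max_left C 0) (Real.rpow_nonneg hNT0 _)).trans
      (mul_le_mul_of_nonneg_left hpow (le_max_right C 0))
  -- lower bound `|Δ| = 64 k¹² ≥ k`
  have hL : (k : ℝ) ≤ ((max |(rescaledModel (k : ℤ)).Δ| (|(rescaledModel (k : ℤ)).c₄| ^ 3) : ℤ) : ℝ) := by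
    rw [rescaledModel_Δ]
    push_cast
    refine le_max_of_le_left ?_
    rw [abs_of_nonneg (by positivity)]
    have : (k : ℝ) ≤ (k : ℝ) ^ 12 := le_self_pow₀ hk1 (by norm_num)
    nlinarith
  have key' : ((max |(rescaledModel (k : ℤ)).Δ| (|(rescaledModel (k : ℤ)).c₄| ^ 3) : ℤ) : ℝ) ≤
      C * ((N : ℝ) * T) ^ ((6 : ℝ) + 1) := by
    simpa only [hNdef, hTdef] using key
  linarith


/-! ## 3. The hypothesis "semistable away from 2" is NOT load-bearing for truth

Dropping `∀ p prime, p ≠ 2 → p² ∤ N` gives a statement that is still a consequence of the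
generalized Szpiro conjecture (hence of `ABC`), so it cannot be refuted short of `¬ ABC`; the
hypothesis is there for the MECHANISM (Ribet–Takahashi degree ratios need multiplicative primes),
not for the truth of the inequality. Information for provers: a proof of the crux that never uses
this hypothesis proves generalized Szpiro with the weighted conductor for all curves. -/

/-- The crux with the semistability-away-from-2 hypothesis removed (everything else verbatim). -/
def WeightedSzpiroBoundWithoutSemistability : Prop :=
  ∀ ε : ℝ, 0 < ε → ∃ C : ℝ, ∀ W₀ : WeierstrassCurve ℤ, (W₀.baseChange ℚ).IsElliptic →
    (∀ v : HeightOneSpectrum ℤ, (W₀.baseChange ℚ).IsMinimalAt v) →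
    ((max |W₀.Δ| (|W₀.c₄| ^ 3) : ℤ) : ℝ) ≤ C * ((((W₀.baseChange ℚ).conductorNorm ℤ : ℕ) : ℝ) *
      ((∏ p ∈ ((W₀.baseChange ℚ).conductorNorm ℤ).primeFactors with
        ¬ p ^ 2 ∣ (W₀.baseChange ℚ).conductorNorm ℤ,
        ((W₀.baseChange ℚ).minimalDiscriminantNorm ℤ).factorization p : ℕ) : ℝ)) ^ (6 + ε)

/-- Sanity: the strengthened statement implies the crux. [folklore] -/
theorem weightedSzpiroBound_of_withoutSemistability (h : WeightedSzpiroBoundWithoutSemistability) :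
    WeightedSzpiroBound :=
  fun ε hε ↦ (h ε hε).imp fun _ hC W₀ hE hmin _ ↦ hC W₀ hE hmin

/-- The strengthened statement (no semistability hypothesis) still follows from the generalized
Szpiro conjecture `GeneralizedSzpiroConjectureBG` (B–G Conj. 12.5.11 ⟺ abc, B–G Thm. 12.5.12):
so the hypothesis cannot be shown necessary by a counterexample unless abc is false. [folklore] -/
theorem withoutSemistability_of_generalizedSzpiroBG (h : GeneralizedSzpiroConjectureBG) :
    WeightedSzpiroBoundWithoutSemistability := by
  intro ε hε
  obtain ⟨C, hC⟩ := h ε hε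
  refine ⟨max C 0, fun W₀ hE hmin ↦ ?_⟩
  haveI := hE
  have key := hC W₀ hE hmin
  have hN : (0 : ℝ) ≤ (((W₀.baseChange ℚ).conductorNorm ℤ : ℕ) : ℝ) := by positivity
  have hT : (1 : ℝ) ≤ ((∏ p ∈ ((W₀.baseChange ℚ).conductorNorm ℤ).primeFactors with
      ¬ p ^ 2 ∣ (W₀.baseChange ℚ).conductorNorm ℤ,
        ((W₀.baseChange ℚ).minimalDiscriminantNorm ℤ).factorization p : ℕ) : ℝ) := by
    exact_mod_cast one_le_weight (W₀.baseChange ℚ)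
  calc _ ≤ C * (((W₀.baseChange ℚ).conductorNorm ℤ : ℕ) : ℝ) ^ (6 + ε) := key
    _ ≤ max C 0 * (((W₀.baseChange ℚ).conductorNorm ℤ : ℕ) : ℝ) ^ (6 + ε) :=
        mul_le_mul_of_nonneg_right (le_max_left _ _) (Real.rpow_nonneg hN _)
    _ ≤ _ := mul_le_mul_of_nonneg_left
        (Real.rpow_le_rpow hN (le_mul_of_one_le_right hN hT) (by linarith)) (le_max_right _ _)

/-- … hence from `ABC` itself. [folklore] -/
theorem withoutSemistability_of_abc (h : _root_.ABC) : WeightedSzpiroBoundWithoutSemistability := by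
  refine withoutSemistability_of_generalizedSzpiroBG (abcLe_iff_generalizedSzpiroBG_holds.mp ?_)
  intro ε hε
  obtain ⟨C, -, hC⟩ := h ε hε
  exact ⟨C, fun a b c ht ↦ (hC a b c ht).le⟩

/-! ## 4. Natural strengthening: `ε = 0` (status: OPEN — neither provable nor refutable here)

`WeightedSzpiroBoundEpsZero`: one absolute `C` with `max (|Δ|, |c₄|³) ≤ C (N·T)⁶`. For the
UNweighted inequality `|Δ| ≤ C N⁶ (log N)^k` this is false (Masser 1990, barrier
`Literature.Barriers.ABC.SzpiroEpsilonCannotBeDropped`, proved in the tree: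
`Literature.Barriers.ABC.masser1990_lowerBound_holds`, `|Δ| ≥ N⁶ exp((24−δ)√(log N)/log log N)`).
The weight ABSORBS Masser's excess: his curves are Frey curves of Stewart–Tijdeman triples built
from `y`-smooth numbers `≤ x`, `y = (log x)^{1/2}`, so they have `ω(N) ≍ √(log N)/log log N`
multiplicative primes with exponents `ord_p Δ ≍ √(log N)·(log log N)/log p`, whence
`log T(E) = Σ_p log ord_p Δ ≍ ω(N)·log log N ≍ √(log N)`, and `T⁶ = exp(≍ 6√(log N))` beats
`exp(24√(log N)/log log N)`. Bennett–Yazdani's second proof (2012, Prop. 7.4: semistable twists with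
`v_p(Δ_E) = 6k + v_p(Δ_F)`, Szpiro ratio `> 6`) is absorbed likewise (`T ≥ 6^{ω}` while the excess
over `N⁶` is `∏_{p ∣ Δ_F} p^{v_p(Δ_F)}`, bounded for fixed `F`). Prime by prime,
`log(|Δ|/(N T)⁶) = Σ_{p ∥ N} [(e_p − 6) log p − 6 log e_p]` (`e_p = ord_p Δ_min`; for Frey curves
`e_p = 2 v_p(abc)` at odd `p`): primes with `e_p ≤ 6` COST `(6 − e_p) log p + 6 log e_p`, and only
prime powers with `p^{e_p − 6} > e_p⁶` gain. A refutation of the `ε = 0` form therefore needs an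
infinite family in which high prime powers outweigh the radical cost of all low-exponent primes —
e.g. abc triples with `a, b, c` essentially cube-full and a member `p^v`, `v ≥ 4`, `p → ∞`
(Pillai/Hall type); none is known, and for `4`-full coprime triples abc itself predicts finiteness.
Conversely abc does NOT obviously imply the `ε = 0` form (its slack `N^{ε}` exceeds `T⁶` when `ω(N)`
is bounded). So the `ε = 0` strengthening is recorded as OPEN (plausibly true, unlike `ε = 0` in
Szpiro); it is NOT claimed by the route. -/

/-- The `ε = 0` strengthening of the crux (one absolute constant, exponent exactly `6`).
Status: open (see the section docstring); recorded so that ideators do not mistake Masser's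
barrier for a refutation of it. -/
def WeightedSzpiroBoundEpsZero : Prop :=
  ∃ C : ℝ, ∀ W₀ : WeierstrassCurve ℤ, (W₀.baseChange ℚ).IsElliptic →
    (∀ v : HeightOneSpectrum ℤ, (W₀.baseChange ℚ).IsMinimalAt v) →
    (∀ p : ℕ, p.Prime → p ≠ 2 → ¬ p ^ 2 ∣ (W₀.baseChange ℚ).conductorNorm ℤ) →
    ((max |W₀.Δ| (|W₀.c₄| ^ 3) : ℤ) : ℝ) ≤ C * ((((W₀.baseChange ℚ).conductorNorm ℤ : ℕ) : ℝ) *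
      ((∏ p ∈ ((W₀.baseChange ℚ).conductorNorm ℤ).primeFactors with
        ¬ p ^ 2 ∣ (W₀.baseChange ℚ).conductorNorm ℤ,
        ((W₀.baseChange ℚ).minimalDiscriminantNorm ℤ).factorization p : ℕ) : ℝ)) ^ (6 : ℕ)

/-- The `ε = 0` form implies the crux (monotonicity in the exponent needs `N·T ≥ 1`, which holds:
`N ≥ 1`, `T ≥ 1`). [folklore] -/
theorem weightedSzpiroBound_of_epsZero (h : WeightedSzpiroBoundEpsZero) : WeightedSzpiroBound := by
  intro ε hε
  obtain ⟨C, hC⟩ := h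
  refine ⟨max C 0, fun W₀ hE hmin hss ↦ ?_⟩
  haveI := hE
  have key := hC W₀ hE hmin hss
  set N : ℕ := (W₀.baseChange ℚ).conductorNorm ℤ with hNdef
  set T : ℕ := ∏ p ∈ N.primeFactors with ¬ p ^ 2 ∣ N,
    ((W₀.baseChange ℚ).minimalDiscriminantNorm ℤ).factorization p with hTdef
  have hN1 : (1 : ℝ) ≤ N := by exact_mod_cast conductorNorm_pos_holds (W₀.baseChange ℚ)
  have hT1 : (1 : ℝ) ≤ T := by exact_mod_cast one_le_weight (W₀.baseChange ℚ)
  have hNT1 : (1 : ℝ) ≤ (N : ℝ) * T := one_le_mul_of_one_le_of_one_le hN1 hT1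
  have hNT0 : (0 : ℝ) ≤ (N : ℝ) * T := zero_le_one.trans hNT1
  have key' : ((max |W₀.Δ| (|W₀.c₄| ^ 3) : ℤ) : ℝ) ≤ C * ((N : ℝ) * T) ^ (6 : ℕ) := by
    simpa only [hNdef, hTdef] using key
  have hmono : ((N : ℝ) * T) ^ (6 : ℕ) ≤ ((N : ℝ) * T) ^ (6 + ε) := by
    rw [← Real.rpow_natCast]
    exact Real.rpow_le_rpow_of_exponent_le hNT1 (by push_cast; linarith)
  calc ((max |W₀.Δ| (|W₀.c₄| ^ 3) : ℤ) : ℝ) ≤ C * ((N : ℝ) * T) ^ (6 : ℕ) := key'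
    _ ≤ max C 0 * ((N : ℝ) * T) ^ (6 : ℕ) :=
        mul_le_mul_of_nonneg_right (le_max_left _ _) (pow_nonneg hNT0 _)
    _ ≤ max C 0 * ((N : ℝ) * T) ^ (6 + ε) := mul_le_mul_of_nonneg_left hmono (le_max_right _ _)


/-! ## 5. Tightness: the exponent `6` cannot be lowered, even with the weight `T(E)`

`WeightedSzpiroBoundExp κ` is the crux with `(N·T)^{6+ε}` replaced by `(N·T)^κ` (one constant).
For every `κ < 6` it is FALSE, by the Frey curves of the triples `1 + (2ⁿ − 1) = 2ⁿ`: the global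
minimal model `freyIntModel₂ (−1) 2ⁿ` (tree, B–G (12.18)) has `c₄ = 4ⁿ − 2ⁿ + 1`, so
`|c₄|³ ≥ 2^{6n}/8`, while `N ∣ rad(2ⁿ(2ⁿ − 1)) ≤ 2^{n+1}` and
`T ≤ τ(|Δ_min|) ≤ C_η |Δ_min|^η ≤ C_η 2^{4nη}` (divisor bound, tree
`Literature.NumberTheory.Sieve.exists_card_divisors_le_mul_rpow`). So the weighted statement is
exactly as sharp as Szpiro's: the weight is worth at most `N^{o(1)}` on this family. -/

/-- The crux with exponent `κ` and one absolute constant. -/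
def WeightedSzpiroBoundExp (κ : ℝ) : Prop :=
  ∃ C : ℝ, ∀ W₀ : WeierstrassCurve ℤ, (W₀.baseChange ℚ).IsElliptic →
    (∀ v : HeightOneSpectrum ℤ, (W₀.baseChange ℚ).IsMinimalAt v) →
    (∀ p : ℕ, p.Prime → p ≠ 2 → ¬ p ^ 2 ∣ (W₀.baseChange ℚ).conductorNorm ℤ) →
    ((max |W₀.Δ| (|W₀.c₄| ^ 3) : ℤ) : ℝ) ≤ C * ((((W₀.baseChange ℚ).conductorNorm ℤ : ℕ) : ℝ) *
      ((∏ p ∈ ((W₀.baseChange ℚ).conductorNorm ℤ).primeFactors with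
        ¬ p ^ 2 ∣ (W₀.baseChange ℚ).conductorNorm ℤ,
        ((W₀.baseChange ℚ).minimalDiscriminantNorm ℤ).factorization p : ℕ) : ℝ)) ^ κ

/-- The crux gives `WeightedSzpiroBoundExp (6 + ε)` for every `ε > 0` (definitional repackaging). [folklore] -/
theorem weightedSzpiroBoundExp_of_weightedSzpiroBound (h : WeightedSzpiroBound) {ε : ℝ} (hε : 0 < ε) :
    WeightedSzpiroBoundExp (6 + ε) :=
  h ε hε

section Tight

open Literature.NumberTheory.Sieve

/-- The test curves: the global minimal Frey models (B–G (12.18)) of `1 + (2ⁿ − 1) = 2ⁿ`,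
`W_n = freyIntModel₂ (−1) (2ⁿ)` : `y² + xy = x³ + 2^{n−2} x² + 2^{n−4} x`. -/
def tightModel (n : ℕ) : WeierstrassCurve ℤ := freyIntModel₂ (-1) (2 ^ n)

variable {n : ℕ}

private theorem hB (hn : 4 ≤ n) : (16 : ℤ) ∣ 2 ^ n := by
  rw [show (16 : ℤ) = 2 ^ 4 by norm_num]
  exact pow_dvd_pow 2 hn

private theorem h4 (hn : 4 ≤ n) : (4 : ℤ) ∣ 2 ^ n - (-1) - 1 := by
  rw [show (2 : ℤ) ^ n - (-1) - 1 = 2 ^ n by ring]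
  exact dvd_trans (by norm_num) (hB hn)

private theorem h16 (hn : 4 ≤ n) : (16 : ℤ) ∣ (-1) * 2 ^ n :=
  dvd_mul_of_dvd_right (hB hn) _

private theorem two_le_two_pow (hn : 4 ≤ n) : (2 : ℤ) ≤ 2 ^ n :=
  calc (2 : ℤ) = 2 ^ 1 := by norm_num
    _ ≤ 2 ^ n := pow_le_pow_right₀ (by norm_num) (by omega)

private theorem h0 (hn : 4 ≤ n) : (-1 : ℤ) * 2 ^ n * (-1 + 2 ^ n) ≠ 0 := by
  have h2 := two_le_two_pow hn
  exact mul_ne_zero (mul_ne_zero (by norm_num) (by positivity)) (by linarith : (0 : ℤ) < -1 + 2 ^ n).ne'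

/-- `c₄ (W_n) = 4ⁿ − 2ⁿ + 1`. [folklore] -/
theorem tightModel_c₄ (hn : 4 ≤ n) : (tightModel n).c₄ = 4 ^ n - 2 ^ n + 1 := by
  rw [tightModel, freyIntModel₂_c₄ (h4 hn) (h16 hn)]
  have : (4 : ℤ) ^ n = (2 ^ n) ^ 2 := by rw [← pow_mul, mul_comm, pow_mul]; norm_num
  rw [this]; ring

/-- `Δ (W_n) = 2^{2n−8} (2ⁿ − 1)²`, written as `(2ⁿ/16)² (2ⁿ − 1)²`. [folklore] -/
theorem tightModel_Δ (hn : 4 ≤ n) : (tightModel n).Δ = (2 ^ n / 16) ^ 2 * (2 ^ n - 1) ^ 2 := by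
  rw [tightModel, freyIntModel₂_Δ (h4 hn) (h16 hn)]
  have h : (-1 : ℤ) * 2 ^ n / 16 = -(2 ^ n / 16) := by
    obtain ⟨e, he⟩ := hB hn
    rw [he]; omega
  rw [h]; ring

/-- `Δ (W_n) = 2^{2(n−4)} (2ⁿ − 1)²` with the division carried out. [folklore] -/
theorem tightModel_Δ' (hn : 4 ≤ n) : (tightModel n).Δ = (2 ^ (n - 4)) ^ 2 * (2 ^ n - 1) ^ 2 := by
  rw [tightModel_Δ hn]
  have h : (2 : ℤ) ^ n / 16 = 2 ^ (n - 4) := by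
    apply Int.ediv_eq_of_eq_mul_left (by norm_num)
    rw [show (16 : ℤ) = 2 ^ 4 by norm_num, ← pow_add, Nat.sub_add_cancel hn]
  rw [h]

/-- `W_n` is an elliptic curve. [folklore] -/
theorem isElliptic_tightModel (hn : 4 ≤ n) : ((tightModel n).baseChange ℚ).IsElliptic :=
  isElliptic_freyIntModel₂ (h0 hn) (h4 hn) (h16 hn)

/-- `W_n` is minimal at every prime (B–G 12.5.10 (a)). [folklore] -/
theorem isMinimalAt_tightModel (hn : 4 ≤ n) (v : HeightOneSpectrum ℤ) :
    ((tightModel n).baseChange ℚ).IsMinimalAt v :=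
  isMinimalAt_freyIntModel₂ isCoprime_one_left.neg_left (by norm_num) (hB hn) v

/-- `N (W_n) ∣ rad (2ⁿ (2ⁿ − 1))` (multiplicative reduction at every bad prime). [folklore] -/
theorem conductorNorm_tightModel_dvd (hn : 4 ≤ n) :
    ((tightModel n).baseChange ℚ).conductorNorm ℤ ∣
      UniqueFactorizationMonoid.radical (2 ^ n * (2 ^ n - 1) : ℕ) := by
  have h := conductorNorm_freyIntModel₂_dvd (A := -1) (B := 2 ^ n) isCoprime_one_left.neg_left
    (h0 hn) (by norm_num) (hB hn)
  have hx : ((-1 : ℤ) * 2 ^ n * (-1 + 2 ^ n)).natAbs = 2 ^ n * (2 ^ n - 1) := by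
    have h1 : (1 : ℕ) ≤ 2 ^ n := Nat.one_le_two_pow
    have : (-1 : ℤ) * 2 ^ n * (-1 + 2 ^ n) = -((2 ^ n * (2 ^ n - 1) : ℕ) : ℤ) := by
      push_cast [Nat.cast_sub h1]
      ring
    rw [this, Int.natAbs_neg, Int.natAbs_natCast]
  rwa [tightModel, ← hx]

/-- `rad (2ⁿ (2ⁿ − 1)) ≤ 2 (2ⁿ − 1)`. [folklore] -/
theorem radical_tight_le (hn : 4 ≤ n) :
    UniqueFactorizationMonoid.radical (2 ^ n * (2 ^ n - 1) : ℕ) ≤ 2 * (2 ^ n - 1) := by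
  have hpos : 0 < 2 ^ n - 1 := Nat.sub_pos_of_lt (Nat.one_lt_two_pow (by omega))
  have hk : 2 * (2 ^ n - 1) ≠ 0 := by omega
  apply Nat.le_of_dvd (by omega)
  rw [Nat.radical_dvd_iff hk]
  intro p hp
  rw [Nat.mem_primeFactors] at hp ⊢
  refine ⟨hp.1, ?_, hk⟩
  rcases (Nat.Prime.dvd_mul hp.1).mp hp.2.1 with h | h
  · have hp2 : p = 2 := (Nat.prime_dvd_prime_iff_eq hp.1 Nat.prime_two).mp (hp.1.dvd_of_dvd_pow h)
    subst hp2
    exact dvd_mul_right 2 _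
  · exact dvd_mul_of_dvd_right h _

/-- `N (W_n) ≤ 2^{n+1}`. [folklore] -/
theorem conductorNorm_tightModel_le (hn : 4 ≤ n) :
    ((tightModel n).baseChange ℚ).conductorNorm ℤ ≤ 2 ^ (n + 1) := by
  have h1 := Nat.le_of_dvd (Nat.radical_pos _) (conductorNorm_tightModel_dvd hn)
  have h2 := radical_tight_le hn
  have h3 : 2 * (2 ^ n - 1) ≤ 2 ^ (n + 1) := by rw [pow_succ]; omega
  omega

/-- `N (W_n)` is squarefree, in particular `p² ∤ N` for every prime `p`. [folklore] -/
theorem not_sq_dvd_conductorNorm_tightModel (hn : 4 ≤ n) {p : ℕ} (hp : p.Prime) :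
    ¬ p ^ 2 ∣ ((tightModel n).baseChange ℚ).conductorNorm ℤ := by
  have hsq : Squarefree (((tightModel n).baseChange ℚ).conductorNorm ℤ) :=
    UniqueFactorizationMonoid.squarefree_radical.squarefree_of_dvd (conductorNorm_tightModel_dvd hn)
  rw [Nat.squarefree_iff_prime_squarefree] at hsq
  rw [sq]
  exact hsq p hp

/-- `|Δ_min (W_n)| = Δ (W_n) ≤ 2^{4n}`. [folklore] -/
theorem minimalDiscriminantNorm_tightModel_le (hn : 4 ≤ n) :
    ((tightModel n).baseChange ℚ).minimalDiscriminantNorm ℤ ≤ 2 ^ (4 * n) := by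
  haveI := isElliptic_tightModel hn
  rw [minimalDiscriminantNorm_eq_natAbs_holds (tightModel n)
    (Δ_ne_zero_of_isElliptic_baseChange_int (tightModel n)) (isMinimalAt_tightModel hn), tightModel_Δ' hn]
  have h1 : ((2 : ℤ) ^ (n - 4)) ^ 2 * (2 ^ n - 1) ^ 2 ≤ (2 ^ n) ^ 2 * (2 ^ n) ^ 2 := by
    have ha : (0 : ℤ) ≤ 2 ^ (n - 4) := by positivity
    have hb : (2 : ℤ) ^ (n - 4) ≤ 2 ^ n := pow_le_pow_right₀ (by norm_num) (Nat.sub_le n 4)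
    have hc : (0 : ℤ) ≤ 2 ^ n - 1 := by have := two_le_two_pow hn; linarith
    have hd : (2 : ℤ) ^ n - 1 ≤ 2 ^ n := by linarith
    exact mul_le_mul (pow_le_pow_left₀ ha hb 2) (pow_le_pow_left₀ hc hd 2) (by positivity) (by positivity)
  have h2 : ((2 : ℤ) ^ n) ^ 2 * (2 ^ n) ^ 2 = 2 ^ (4 * n) := by ring
  have h0' : (0 : ℤ) ≤ ((2 : ℤ) ^ (n - 4)) ^ 2 * (2 ^ n - 1) ^ 2 := by positivity
  zify
  rw [abs_of_nonneg h0', ← h2]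
  exact h1

/-- `T ≤ τ(|Δ_min|)`: the weight is at most the number of divisors of the minimal discriminant. [folklore] -/
theorem weight_le_card_divisors (W : WeierstrassCurve ℚ) [W.IsElliptic] :
    ∏ p ∈ (W.conductorNorm ℤ).primeFactors with ¬ p ^ 2 ∣ W.conductorNorm ℤ,
        (W.minimalDiscriminantNorm ℤ).factorization p ≤ (W.minimalDiscriminantNorm ℤ).divisors.card := by
  have hND : W.conductorNorm ℤ ∣ W.minimalDiscriminantNorm ℤ :=
    conductorNorm_dvd_minimalDiscriminantNorm W (finite_setOf_ordMinimalDiscriminant_ne_zero_holds (A := ℤ) W)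
  have hD0 : W.minimalDiscriminantNorm ℤ ≠ 0 := (minimalDiscriminantNorm_pos_holds W).ne'
  rw [Nat.card_divisors hD0]
  calc ∏ p ∈ (W.conductorNorm ℤ).primeFactors with ¬ p ^ 2 ∣ W.conductorNorm ℤ,
        (W.minimalDiscriminantNorm ℤ).factorization p
      ≤ ∏ p ∈ (W.conductorNorm ℤ).primeFactors with ¬ p ^ 2 ∣ W.conductorNorm ℤ,
        ((W.minimalDiscriminantNorm ℤ).factorization p + 1) :=
          Finset.prod_le_prod (fun _ _ ↦ Nat.zero_le _) (fun _ _ ↦ Nat.le_succ _)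
    _ ≤ ∏ p ∈ (W.minimalDiscriminantNorm ℤ).primeFactors, ((W.minimalDiscriminantNorm ℤ).factorization p + 1) := by
          refine Finset.prod_le_prod_of_subset_of_one_le' ?_ (fun _ _ _ ↦ Nat.le_add_left 1 _)
          intro p hp
          rw [Finset.mem_filter] at hp
          have hp' := Nat.mem_primeFactors.mp hp.1
          exact Nat.mem_primeFactors.mpr ⟨hp'.1, hp'.2.1.trans hND, hD0⟩

/-- `c₄ (W_n) ≥ (2ⁿ)²/2`. [folklore] -/
theorem tightModel_c₄_ge (hn : 4 ≤ n) : ((2 : ℝ) ^ n) ^ 2 / 2 ≤ ((tightModel n).c₄ : ℝ) := by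
  rw [tightModel_c₄ hn]
  push_cast
  have h4 : (4 : ℝ) ^ n = ((2 : ℝ) ^ n) ^ 2 := by
    rw [show (4 : ℝ) = 2 ^ 2 by norm_num, ← pow_mul, pow_mul']
  rw [h4]
  nlinarith [sq_nonneg ((2 : ℝ) ^ n - 1)]

/-- **The exponent `6` is sharp for the weighted statement**: for every `κ < 6`,
`WeightedSzpiroBoundExp κ` is false (witness family `tightModel n`, the minimal Frey models of
`1 + (2ⁿ − 1) = 2ⁿ`; `|c₄|³ ≥ 2^{6n}/8` against `N ≤ 2^{n+1}`, `T ≤ τ(|Δ_min|) ≤ C_η 2^{4nη}`).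
[folklore] -/
theorem weightedSzpiroBoundExp_false_of_lt_six {κ : ℝ} (hκ : κ < 6) : ¬ WeightedSzpiroBoundExp κ := by
  rintro ⟨C, hC⟩
  -- exponents
  set k : ℝ := max κ 0 with hk
  have hk0 : 0 ≤ k := le_max_right _ _
  have hk6 : k < 6 := max_lt hκ (by norm_num)
  set η : ℝ := (6 - k) / 48 with hη
  have hη0 : 0 < η := by rw [hη]; linarith
  set e : ℝ := (1 + 4 * η) * k with he
  set g : ℝ := 6 - e with hg
  have hg0 : 0 < g := by
    rw [hg, he, hη]
    nlinarith [mul_pos (sub_pos.2 hk6) (by linarith : (0 : ℝ) < 12 - k)]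
  -- divisor bound
  obtain ⟨Cη, hCη1, hτ⟩ := exists_card_divisors_le_mul_rpow hη0
  have hCη0 : 0 < Cη := by linarith
  -- the constant to beat and the parameter `n`
  set M : ℝ := 8 * (max C 0 * (2 * Cη) ^ k) with hM
  have h2g : (1 : ℝ) < (2 : ℝ) ^ g := Real.one_lt_rpow (by norm_num) hg0
  obtain ⟨n₀, hn₀⟩ := pow_unbounded_of_one_lt M h2g
  set n : ℕ := n₀ + 4 with hn
  have hn4 : 4 ≤ n := by omega
  have hMn : M < ((2 : ℝ) ^ g) ^ n := hn₀.trans_le (pow_le_pow_right₀ h2g.le (by omega))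
  -- the curve `W_n`
  haveI hE := isElliptic_tightModel hn4
  have key := hC (tightModel n) hE (isMinimalAt_tightModel hn4)
    (fun p hp _ ↦ not_sq_dvd_conductorNorm_tightModel hn4 hp)
  set N : ℕ := ((tightModel n).baseChange ℚ).conductorNorm ℤ with hNdef
  set D : ℕ := ((tightModel n).baseChange ℚ).minimalDiscriminantNorm ℤ with hDdef
  set T : ℕ := ∏ p ∈ N.primeFactors with ¬ p ^ 2 ∣ N, D.factorization p with hTdef
  have key' : ((max |(tightModel n).Δ| (|(tightModel n).c₄| ^ 3) : ℤ) : ℝ) ≤ C * ((N : ℝ) * T) ^ κ := by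
    simpa only [hNdef, hTdef, hDdef] using key
  -- `x = 2ⁿ`
  set x : ℝ := (2 : ℝ) ^ n with hx
  have hx0 : (0 : ℝ) < x := by positivity
  -- `N ≤ 2x`, `N ≥ 1`
  have hN : (N : ℝ) ≤ 2 * x := by
    calc (N : ℝ) ≤ ((2 ^ (n + 1) : ℕ) : ℝ) := by exact_mod_cast conductorNorm_tightModel_le hn4
      _ = 2 * x := by rw [hx]; push_cast; ring
  have hN1 : (1 : ℝ) ≤ N := by exact_mod_cast conductorNorm_pos_holds ((tightModel n).baseChange ℚ)
  -- `T ≤ Cη x^{4η}`, `T ≥ 1`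
  have hD0 : D ≠ 0 := (minimalDiscriminantNorm_pos_holds _).ne'
  have hDle : (D : ℝ) ≤ x ^ (4 : ℕ) := by
    calc (D : ℝ) ≤ ((2 ^ (4 * n) : ℕ) : ℝ) := by exact_mod_cast minimalDiscriminantNorm_tightModel_le hn4
      _ = x ^ 4 := by rw [hx]; push_cast; rw [← pow_mul, mul_comm]
  have hT1 : (1 : ℝ) ≤ T := by exact_mod_cast one_le_weight ((tightModel n).baseChange ℚ)
  have hT : (T : ℝ) ≤ Cη * x ^ (4 * η) := by
    have h1 : (T : ℝ) ≤ (D.divisors.card : ℝ) := by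
      exact_mod_cast weight_le_card_divisors ((tightModel n).baseChange ℚ)
    have h2 : (D.divisors.card : ℝ) ≤ Cη * (D : ℝ) ^ η := hτ D hD0
    have h3 : (D : ℝ) ^ η ≤ (x ^ (4 : ℕ)) ^ η := Real.rpow_le_rpow (by positivity) hDle hη0.le
    have h4 : (x ^ (4 : ℕ)) ^ η = x ^ (4 * η) := by
      rw [← Real.rpow_natCast x 4, ← Real.rpow_mul hx0.le]
      norm_num
    calc (T : ℝ) ≤ Cη * (D : ℝ) ^ η := h1.trans h2
      _ ≤ Cη * (x ^ (4 : ℕ)) ^ η := mul_le_mul_of_nonneg_left h3 hCη0.le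
      _ = Cη * x ^ (4 * η) := by rw [h4]
  -- `N T ≤ 2 Cη x^{1+4η}`
  have hNT1 : (1 : ℝ) ≤ (N : ℝ) * T := one_le_mul_of_one_le_of_one_le hN1 hT1
  have hNT : (N : ℝ) * T ≤ 2 * Cη * x ^ (1 + 4 * η) := by
    have hsplit : x ^ (1 + 4 * η) = x * x ^ (4 * η) := by rw [Real.rpow_add hx0, Real.rpow_one]
    rw [hsplit]
    calc (N : ℝ) * T ≤ (2 * x) * (Cη * x ^ (4 * η)) :=
          mul_le_mul hN hT (by positivity) (by positivity)
      _ = 2 * Cη * (x * x ^ (4 * η)) := by ring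
  -- `(N T)^κ ≤ (2 Cη)^k x^e`
  have h2C : (0 : ℝ) ≤ 2 * Cη := by linarith
  have hpow : ((N : ℝ) * T) ^ κ ≤ (2 * Cη) ^ k * x ^ e := by
    calc ((N : ℝ) * T) ^ κ ≤ ((N : ℝ) * T) ^ k :=
          Real.rpow_le_rpow_of_exponent_le hNT1 (le_max_left _ _)
      _ ≤ (2 * Cη * x ^ (1 + 4 * η)) ^ k := Real.rpow_le_rpow (by positivity) hNT hk0
      _ = (2 * Cη) ^ k * (x ^ (1 + 4 * η)) ^ k :=
          Real.mul_rpow h2C (Real.rpow_nonneg hx0.le _)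
      _ = (2 * Cη) ^ k * x ^ e := by rw [← Real.rpow_mul hx0.le, he]
  -- `RHS ≤ (M/8) x^e`
  have hR : C * ((N : ℝ) * T) ^ κ ≤ M / 8 * x ^ e := by
    calc C * ((N : ℝ) * T) ^ κ ≤ max C 0 * ((N : ℝ) * T) ^ κ :=
          mul_le_mul_of_nonneg_right (le_max_left _ _) (Real.rpow_nonneg (by positivity) _)
      _ ≤ max C 0 * ((2 * Cη) ^ k * x ^ e) := mul_le_mul_of_nonneg_left hpow (le_max_right _ _)
      _ = M / 8 * x ^ e := by rw [hM]; ring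
  -- `LHS ≥ x⁶/8`
  have hL : x ^ (6 : ℕ) / 8 ≤ ((max |(tightModel n).Δ| (|(tightModel n).c₄| ^ 3) : ℤ) : ℝ) := by
    have hc := tightModel_c₄_ge hn4
    rw [← hx] at hc
    have hc0 : (0 : ℝ) ≤ ((tightModel n).c₄ : ℝ) := le_trans (by positivity) hc
    push_cast
    refine le_max_of_le_right ?_
    rw [abs_of_nonneg hc0]
    calc x ^ (6 : ℕ) / 8 = (x ^ 2 / 2) ^ 3 := by ring
      _ ≤ ((tightModel n).c₄ : ℝ) ^ 3 := pow_le_pow_left₀ (by positivity) hc 3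
  -- `x⁶ = x^g x^e` and `(2^g)^n = x^g`
  have hxg : x ^ (6 : ℕ) = x ^ g * x ^ e := by
    rw [← Real.rpow_natCast x 6, ← Real.rpow_add hx0, hg]
    norm_num
  have hxg' : ((2 : ℝ) ^ g) ^ n = x ^ g := by
    rw [hx, ← Real.rpow_natCast ((2 : ℝ) ^ g) n, ← Real.rpow_mul (by norm_num : (0 : ℝ) ≤ 2),
      mul_comm, Real.rpow_mul (by norm_num : (0 : ℝ) ≤ 2), Real.rpow_natCast]
  -- combine
  have hxe0 : 0 < x ^ e := Real.rpow_pos_of_pos hx0 e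
  have h1 : x ^ g * x ^ e / 8 ≤ M / 8 * x ^ e := by
    rw [← hxg]
    exact hL.trans (key'.trans hR)
  have h2 : x ^ g * x ^ e ≤ M * x ^ e := by linarith
  have h3 : x ^ g ≤ M := le_of_mul_le_mul_right h2 hxe0
  rw [hxg'] at hMn
  linarith

/-- Corollary: no exponent below `6` works in the crux, weight or no weight. [folklore] -/
theorem not_exists_weightedSzpiroBoundExp_lt_six : ¬ ∃ κ : ℝ, κ < 6 ∧ WeightedSzpiroBoundExp κ :=
  fun ⟨_, hκ, h⟩ ↦ weightedSzpiroBoundExp_false_of_lt_six hκ h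

end Tight


/-! ## 7. Strength certificate: the crux ALONE is abc-hard in the few-prime (Pillai) regime

Unconditionally `T(E) ≤ (log₂|Δ_min|)^{ω(N)}`, so for curves with a bounded number of bad primes
the weight is a poly-logarithm and the crux collapses to generalized Szpiro for those curves
(`szpiroFewBadPrimes_of_weightedSzpiroBound`), hence — via the Frey curve — to the abc conjecture
for triples supported on a bounded number of primes (`abcBoundedOmega_of_weightedSzpiroBound`),
which is open (Stewart–Yu is the state of the art; cf. the route's r4 `FewPrimeValuationProduct`).
So the crux does not become easier than abc by restricting to few primes: its only soft direction
is the many-prime regime, where `T` can be `N^{o(1)}`-large (Masser-type families). -/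

section Strength

open Real

/-- Generalized Szpiro (B–G 12.5.11 shape) for curves semistable away from `2` whose conductor has
at most `B` prime factors. Open for every `B ≥ 2`. -/
def SzpiroFewBadPrimes (B : ℕ) : Prop :=
  ∀ ε : ℝ, 0 < ε → ∃ C : ℝ, ∀ W₀ : WeierstrassCurve ℤ, (W₀.baseChange ℚ).IsElliptic →
    (∀ v : HeightOneSpectrum ℤ, (W₀.baseChange ℚ).IsMinimalAt v) →
    (∀ p : ℕ, p.Prime → p ≠ 2 → ¬ p ^ 2 ∣ (W₀.baseChange ℚ).conductorNorm ℤ) →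
    ((W₀.baseChange ℚ).conductorNorm ℤ).primeFactors.card ≤ B →
    ((max |W₀.Δ| (|W₀.c₄| ^ 3) : ℤ) : ℝ) ≤ C * ((((W₀.baseChange ℚ).conductorNorm ℤ : ℕ) : ℝ)) ^ (6 + ε)

/-- `ord_p (D) ≤ log₂ D` for `D ≥ 1`. [folklore] -/
theorem natCast_factorization_le_log (D p : ℕ) (hD : D ≠ 0) :
    ((D.factorization p : ℕ) : ℝ) ≤ Real.log D / Real.log 2 := by
  have hlog2 : 0 < Real.log 2 := Real.log_pos (by norm_num)
  rw [le_div_iff₀ hlog2, ← Real.log_pow]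
  by_cases hp : p.Prime
  · have h1 : 2 ^ D.factorization p ≤ D :=
      (Nat.pow_le_pow_left hp.two_le _).trans (Nat.ordProj_le p hD)
    have h2 : ((2 : ℝ) ^ D.factorization p) ≤ D := by exact_mod_cast h1
    exact Real.log_le_log (by positivity) h2
  · rw [Nat.factorization_eq_zero_of_not_prime _ hp, pow_zero, Real.log_one]
    exact Real.log_nonneg (by exact_mod_cast Nat.one_le_iff_ne_zero.mpr hD)

/-- The weight is a poly-logarithm of the minimal discriminant: `T ≤ (max 1 (log₂ |Δ(W₀)|))^B` for a
global minimal `W₀` whose conductor has at most `B` prime factors. [folklore] -/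
theorem weight_le_log_pow (W₀ : WeierstrassCurve ℤ) [hE : (W₀.baseChange ℚ).IsElliptic]
    (hmin : ∀ v : HeightOneSpectrum ℤ, (W₀.baseChange ℚ).IsMinimalAt v) {B : ℕ}
    (hB : ((W₀.baseChange ℚ).conductorNorm ℤ).primeFactors.card ≤ B) :
    ((∏ p ∈ ((W₀.baseChange ℚ).conductorNorm ℤ).primeFactors with
        ¬ p ^ 2 ∣ (W₀.baseChange ℚ).conductorNorm ℤ,
        ((W₀.baseChange ℚ).minimalDiscriminantNorm ℤ).factorization p : ℕ) : ℝ) ≤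
      (max 1 (Real.log |(W₀.Δ : ℝ)| / Real.log 2)) ^ B := by
  set N := (W₀.baseChange ℚ).conductorNorm ℤ with hN
  set D := (W₀.baseChange ℚ).minimalDiscriminantNorm ℤ with hD
  set L : ℝ := max 1 (Real.log |(W₀.Δ : ℝ)| / Real.log 2) with hL
  have hD0 : D ≠ 0 := (minimalDiscriminantNorm_pos_holds _).ne'
  have hDΔ : (D : ℝ) = |(W₀.Δ : ℝ)| := by
    rw [hD, minimalDiscriminantNorm_eq_natAbs_holds W₀ (Δ_ne_zero_of_isElliptic_baseChange_int W₀) hmin,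
      Nat.cast_natAbs, Int.cast_abs]
  have hfac : ∀ p ∈ N.primeFactors.filter (fun p ↦ ¬ p ^ 2 ∣ N), ((D.factorization p : ℕ) : ℝ) ≤ L := by
    intro p _
    refine (natCast_factorization_le_log D p hD0).trans ?_
    rw [hDΔ]
    exact le_max_right _ _
  have hL1 : 1 ≤ L := le_max_left _ _
  push_cast
  calc ∏ p ∈ N.primeFactors.filter (fun p ↦ ¬ p ^ 2 ∣ N), ((D.factorization p : ℕ) : ℝ)
      ≤ ∏ p ∈ N.primeFactors.filter (fun p ↦ ¬ p ^ 2 ∣ N), L :=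
        Finset.prod_le_prod (fun _ _ ↦ by positivity) hfac
    _ = L ^ (N.primeFactors.filter (fun p ↦ ¬ p ^ 2 ∣ N)).card := Finset.prod_const L
    _ ≤ L ^ B := pow_le_pow_right₀ hL1 ((Finset.card_filter_le _ _).trans hB)

/-- **The crux implies generalized Szpiro for curves with boundedly many bad primes** (so it is
abc-hard already in the Pillai regime, with no help from the many-prime items r2/r4 of the route).
Proof: `T ≤ (log₂ M)^B ≤ K^B M^{δB}` with `M = max(|Δ|,|c₄|³)`, absorb `M^θ` (`θ = ε/(2(6+ε))`)
into the left-hand side and take the `1/(1−θ)`-th power. [folklore] -/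
theorem szpiroFewBadPrimes_of_weightedSzpiroBound (h : WeightedSzpiroBound) (B : ℕ) :
    SzpiroFewBadPrimes B := by
  intro ε hε
  -- parameters
  set θ : ℝ := ε / (2 * (6 + ε)) with hθ
  have hθ0 : 0 < θ := by positivity
  have h26 : (0 : ℝ) < 2 * (6 + ε) := by positivity
  have hθ1 : θ < 1 := by rw [hθ, div_lt_one h26]; linarith
  have h1θ : 0 < 1 - θ := by linarith
  set ε₁ : ℝ := ε / 2 with hε₁
  have hε₁0 : 0 < ε₁ := by positivity
  obtain ⟨C₁, hC₁⟩ := h ε₁ hε₁0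
  set δ : ℝ := θ / (((B : ℝ) + 1) * (6 + ε₁)) with hδ
  have hδ0 : 0 < δ := by positivity
  have hlog2 : 0 < Real.log 2 := Real.log_pos (by norm_num)
  set K : ℝ := 1 / (δ * Real.log 2) + 1 with hK
  have hK0 : 0 < K := by positivity
  have hK1 : 1 ≤ K := by rw [hK]; exact le_add_of_nonneg_left (by positivity)
  set A₀ : ℝ := max C₁ 0 * K ^ ((B : ℝ) * (6 + ε₁)) with hA₀
  have hA₀0 : 0 ≤ A₀ := mul_nonneg (le_max_right _ _) (Real.rpow_nonneg hK0.le _)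
  refine ⟨A₀ ^ (1 / (1 - θ)), fun W₀ hE hmin hss hB ↦ ?_⟩
  haveI := hE
  have key := hC₁ W₀ hE hmin hss
  set N : ℝ := ((((W₀.baseChange ℚ).conductorNorm ℤ : ℕ) : ℝ)) with hNdef
  set T : ℝ := ((∏ p ∈ ((W₀.baseChange ℚ).conductorNorm ℤ).primeFactors with
        ¬ p ^ 2 ∣ (W₀.baseChange ℚ).conductorNorm ℤ,
        ((W₀.baseChange ℚ).minimalDiscriminantNorm ℤ).factorization p : ℕ) : ℝ) with hTdef
  set M : ℝ := ((max |W₀.Δ| (|W₀.c₄| ^ 3) : ℤ) : ℝ) with hMdef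
  -- basic positivity
  have hN1 : 1 ≤ N := by rw [hNdef]; exact_mod_cast conductorNorm_pos_holds (W₀.baseChange ℚ)
  have hN0 : 0 ≤ N := zero_le_one.trans hN1
  have hT1 : 1 ≤ T := by rw [hTdef]; exact_mod_cast one_le_weight (W₀.baseChange ℚ)
  have hT0 : 0 ≤ T := zero_le_one.trans hT1
  have hΔ1 : (1 : ℝ) ≤ |(W₀.Δ : ℝ)| := by
    have h1 : (1 : ℤ) ≤ |W₀.Δ| := Int.one_le_abs (Δ_ne_zero_of_isElliptic_baseChange_int W₀)
    exact_mod_cast h1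
  have hMΔ : |(W₀.Δ : ℝ)| ≤ M := by
    rw [hMdef]; push_cast; exact le_max_left _ _
  have hM1 : 1 ≤ M := hΔ1.trans hMΔ
  have hM0 : 0 < M := one_pos.trans_le hM1
  -- `T ≤ (K M^δ)^B`
  have hLK : max 1 (Real.log |(W₀.Δ : ℝ)| / Real.log 2) ≤ K * M ^ δ := by
    have hMδ1 : 1 ≤ M ^ δ := Real.one_le_rpow hM1 hδ0.le
    have hlogM : Real.log M ≤ M ^ δ / δ := Real.log_le_rpow_div hM0.le hδ0
    have hlogΔ : Real.log |(W₀.Δ : ℝ)| ≤ Real.log M := Real.log_le_log (by positivity) hMΔ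
    refine max_le ?_ ?_
    · exact hMδ1.trans (le_mul_of_one_le_left (by positivity) hK1)
    · have hδl : δ * Real.log 2 ≠ 0 := by positivity
      calc Real.log |(W₀.Δ : ℝ)| / Real.log 2 ≤ (M ^ δ / δ) / Real.log 2 :=
            div_le_div_of_nonneg_right (hlogΔ.trans hlogM) hlog2.le
        _ = (1 / (δ * Real.log 2)) * M ^ δ := by field_simp
        _ ≤ K * M ^ δ := mul_le_mul_of_nonneg_right (by rw [hK]; linarith) (by positivity)
  have hT : T ≤ (K * M ^ δ) ^ B :=
    (weight_le_log_pow W₀ hmin hB).trans (pow_le_pow_left₀ (by positivity) hLK B)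
  -- `T^{6+ε₁} ≤ K^{B(6+ε₁)} M^θ`
  have hKM0 : 0 ≤ K * M ^ δ := by positivity
  have hT6 : T ^ (6 + ε₁) ≤ K ^ ((B : ℝ) * (6 + ε₁)) * M ^ θ := by
    have h1 : T ^ (6 + ε₁) ≤ ((K * M ^ δ) ^ B) ^ (6 + ε₁) :=
      Real.rpow_le_rpow hT0 hT (by positivity)
    have h2 : ((K * M ^ δ) ^ B) ^ (6 + ε₁) = K ^ ((B : ℝ) * (6 + ε₁)) * M ^ (δ * ((B : ℝ) * (6 + ε₁))) := by
      rw [← Real.rpow_natCast (K * M ^ δ) B, ← Real.rpow_mul hKM0, Real.mul_rpow hK0.le (by positivity),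
        ← Real.rpow_mul hM0.le]
    have h3 : M ^ (δ * ((B : ℝ) * (6 + ε₁))) ≤ M ^ θ := by
      apply Real.rpow_le_rpow_of_exponent_le hM1
      have h6 : (6 : ℝ) + ε₁ ≠ 0 := by positivity
      have hB1 : (B : ℝ) + 1 ≠ 0 := by positivity
      rw [hδ, show θ / (((B : ℝ) + 1) * (6 + ε₁)) * ((B : ℝ) * (6 + ε₁)) = θ * ((B : ℝ) / ((B : ℝ) + 1)) by
        field_simp]
      exact mul_le_of_le_one_right hθ0.le ((div_le_one (by positivity)).mpr (by linarith))
    calc T ^ (6 + ε₁) ≤ ((K * M ^ δ) ^ B) ^ (6 + ε₁) := h1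
      _ = K ^ ((B : ℝ) * (6 + ε₁)) * M ^ (δ * ((B : ℝ) * (6 + ε₁))) := h2
      _ ≤ K ^ ((B : ℝ) * (6 + ε₁)) * M ^ θ := mul_le_mul_of_nonneg_left h3 (Real.rpow_nonneg hK0.le _)
  -- `M ≤ A₀ N^{6+ε₁} M^θ`
  have hMA : M ≤ A₀ * N ^ (6 + ε₁) * M ^ θ := by
    calc M ≤ C₁ * (N * T) ^ (6 + ε₁) := key
      _ ≤ max C₁ 0 * (N * T) ^ (6 + ε₁) :=
          mul_le_mul_of_nonneg_right (le_max_left _ _) (Real.rpow_nonneg (by positivity) _)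
      _ = max C₁ 0 * N ^ (6 + ε₁) * T ^ (6 + ε₁) := by rw [Real.mul_rpow hN0 hT0]; ring
      _ ≤ max C₁ 0 * N ^ (6 + ε₁) * (K ^ ((B : ℝ) * (6 + ε₁)) * M ^ θ) :=
          mul_le_mul_of_nonneg_left hT6 (mul_nonneg (le_max_right _ _) (Real.rpow_nonneg hN0 _))
      _ = A₀ * N ^ (6 + ε₁) * M ^ θ := by rw [hA₀]; ring
  -- divide by `M^θ`
  have hM1θ : M ^ (1 - θ) ≤ A₀ * N ^ (6 + ε₁) := by
    have hprod : M ^ (1 - θ) * M ^ θ = M := by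
      rw [← Real.rpow_add hM0, sub_add_cancel, Real.rpow_one]
    have hθpos : 0 < M ^ θ := Real.rpow_pos_of_pos hM0 θ
    have h' : M ^ (1 - θ) * M ^ θ ≤ (A₀ * N ^ (6 + ε₁)) * M ^ θ := by rw [hprod]; exact hMA
    exact le_of_mul_le_mul_right h' hθpos
  -- raise to the power `1/(1-θ)`
  have hfin : M ≤ (A₀ * N ^ (6 + ε₁)) ^ (1 / (1 - θ)) := by
    have h' := Real.rpow_le_rpow (Real.rpow_nonneg hM0.le _) hM1θ (by positivity : (0 : ℝ) ≤ 1 / (1 - θ))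
    rwa [← Real.rpow_mul hM0.le, mul_one_div_cancel h1θ.ne', Real.rpow_one] at h'
  have hexp : (6 + ε₁) * (1 / (1 - θ)) = 6 + ε := by
    have h12 : (12 : ℝ) + ε ≠ 0 := by positivity
    have h1θ' : 1 - θ = (12 + ε) / (2 * (6 + ε)) := by
      rw [hθ]; field_simp; ring
    rw [h1θ', hε₁]
    field_simp
    ring
  calc M ≤ (A₀ * N ^ (6 + ε₁)) ^ (1 / (1 - θ)) := hfin
    _ = A₀ ^ (1 / (1 - θ)) * N ^ ((6 + ε₁) * (1 / (1 - θ))) := by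
        rw [Real.mul_rpow hA₀0 (Real.rpow_nonneg hN0 _), ← Real.rpow_mul hN0]
    _ = A₀ ^ (1 / (1 - θ)) * N ^ (6 + ε) := by rw [hexp]

/-- The abc conjecture for triples supported on at most `B` primes (`ω(abc) ≤ B`): open for every
`B ≥ 3` (uniformly in the primes; Stewart–Yu's `exp(C rad^{1/3}(log rad)³)` is the record). -/
def AbcBoundedOmega (B : ℕ) : Prop :=
  ∀ ε : ℝ, 0 < ε → ∃ C : ℝ, ∀ a b c : ℕ, Literature.NumberTheory.DiophantineGeometry.IsABCTriple a b c →
    (a * b * c).primeFactors.card ≤ B →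
    (c : ℝ) ≤ C * ((Literature.NumberTheory.DiophantineGeometry.rad a b c : ℕ) : ℝ) ^ (1 + ε)

/-- For the minimal Frey model `W₀` of an abc triple (`exists_minimal_frey_model`: `N ∣ 2¹⁰ rad`):
`N` is squarefree away from `2` and has at most `ω(abc) + 1` prime factors. [folklore] -/
theorem frey_conductor_facts {a b c : ℕ} {N : ℕ}
    (hN : N ∣ 2 ^ 10 * Literature.NumberTheory.DiophantineGeometry.rad a b c) :
    (∀ p : ℕ, p.Prime → p ≠ 2 → ¬ p ^ 2 ∣ N) ∧ N.primeFactors.card ≤ (a * b * c).primeFactors.card + 1 := by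
  rw [Literature.NumberTheory.DiophantineGeometry.rad_def] at hN
  have hr0 : UniqueFactorizationMonoid.radical (a * b * c) ≠ 0 := UniqueFactorizationMonoid.radical_ne_zero
  constructor
  · intro p hp hp2 hdvd
    have hcop : Nat.Coprime (p ^ 2) (2 ^ 10) :=
      Nat.Coprime.pow 2 10 ((Nat.coprime_primes hp Nat.prime_two).mpr hp2)
    have h1 : p ^ 2 ∣ UniqueFactorizationMonoid.radical (a * b * c) :=
      hcop.dvd_of_dvd_mul_left (hdvd.trans hN)
    have hsq := UniqueFactorizationMonoid.squarefree_radical (a := a * b * c)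
    rw [Nat.squarefree_iff_prime_squarefree] at hsq
    exact hsq p hp (by rwa [sq] at h1)
  · have hsub : N.primeFactors ⊆ insert 2 (a * b * c).primeFactors := by
      refine (Nat.primeFactors_mono hN (mul_ne_zero (by norm_num) hr0)).trans ?_
      rw [Nat.primeFactors_mul (by norm_num) hr0, Nat.primeFactors_prime_pow (by norm_num) Nat.prime_two,
        Nat.primeFactors_radical]
      intro p hp
      simpa using hp
    calc N.primeFactors.card ≤ (insert 2 (a * b * c).primeFactors).card := Finset.card_le_card hsub
      _ ≤ (a * b * c).primeFactors.card + 1 := Finset.card_insert_le _ _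

/-- `SzpiroFewBadPrimes (B + 1)` implies abc for `ω(abc) ≤ B` — the Frey-curve argument of
Bombieri–Gubler Thm. 12.5.12 (c) ⟹ (a), verbatim from the tree's `abcLe_of_generalizedSzpiroBG`
with the two extra hypotheses discharged by `frey_conductor_facts`. [cite: BombieriGubler2006, Thm. 12.5.12 (c) ⟹ (a)] -/
theorem abcBoundedOmega_of_szpiroFewBadPrimes {B : ℕ} (hS : SzpiroFewBadPrimes (B + 1)) :
    AbcBoundedOmega B := by
  intro ε hε
  obtain ⟨C₁, hC₁⟩ := hS (6 * ε) (by positivity)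
  set C : ℝ := max C₁ 1 with hCdef
  have hC0 : 0 < C := one_pos.trans_le (le_max_right _ _)
  set M : ℝ := 8 * C * ((2 : ℝ) ^ 10) ^ (6 + 6 * ε) with hMdef
  have hM0 : 0 ≤ M := by positivity
  refine ⟨M ^ (1 / 6 : ℝ), fun a b c h hω ↦ ?_⟩
  obtain ⟨W₀, hE, hmin, hN, hc₄⟩ := exists_minimal_frey_model h
  haveI := hE
  obtain ⟨hss, hcard⟩ := frey_conductor_facts hN
  have key := hC₁ W₀ hE hmin hss (hcard.trans (by omega))
  set N : ℝ := (((W₀.baseChange ℚ).conductorNorm ℤ : ℕ) : ℝ) with hNdef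
  set R : ℝ := ((Literature.NumberTheory.DiophantineGeometry.rad a b c : ℕ) : ℝ) with hRdef
  have hN0 : 0 ≤ N := by positivity
  have hR0 : 0 ≤ R := by positivity
  have he0 : 0 ≤ 6 + 6 * ε := by positivity
  -- `|c₄|³ ≤ C N^{6+6ε}`
  have h1 : |(W₀.c₄ : ℝ)| ^ 3 ≤ C * N ^ (6 + 6 * ε) := by
    have h := le_of_max_le_right (by simpa [Int.cast_max, Int.cast_abs, Int.cast_pow] using key)
    exact h.trans (mul_le_mul_of_nonneg_right (le_max_left _ _) (by positivity))
  -- `N ≤ 2¹⁰ R`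
  have h2 : N ≤ 2 ^ 10 * R := by
    have := Nat.le_of_dvd (mul_pos (by positivity)
      (by rw [Literature.NumberTheory.DiophantineGeometry.rad_def]; exact Nat.radical_pos _)) hN
    rw [hNdef, hRdef]; exact_mod_cast this
  -- `c⁶ ≤ 8 |c₄|³ ≤ M R^{6+6ε}`
  have h3 : (c : ℝ) ^ 6 ≤ M * R ^ (6 + 6 * ε) := by
    have hc2 : (c : ℝ) ^ 2 ≤ 2 * |(W₀.c₄ : ℝ)| := by exact_mod_cast hc₄
    calc (c : ℝ) ^ 6 = ((c : ℝ) ^ 2) ^ 3 := by ring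
      _ ≤ (2 * |(W₀.c₄ : ℝ)|) ^ 3 := pow_le_pow_left₀ (by positivity) hc2 3
      _ = 8 * |(W₀.c₄ : ℝ)| ^ 3 := by ring
      _ ≤ 8 * (C * N ^ (6 + 6 * ε)) := by linarith
      _ ≤ 8 * (C * (2 ^ 10 * R) ^ (6 + 6 * ε)) := by gcongr
      _ = M * R ^ (6 + 6 * ε) := by
          rw [hMdef, Real.mul_rpow (by positivity) hR0]; ring
  -- sixth roots
  have h4 := Real.rpow_le_rpow (by positivity) h3 (by norm_num : (0 : ℝ) ≤ 1 / 6)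
  rw [← Real.rpow_natCast (c : ℝ) 6, ← Real.rpow_mul (by positivity), Real.mul_rpow hM0 (by positivity),
    ← Real.rpow_mul hR0] at h4
  norm_num at h4
  rwa [show (6 + 6 * ε) * (1 / 6) = 1 + ε by ring] at h4

/-- **Strength certificate**: the crux alone implies abc for triples supported on any bounded number
of primes (Pillai/Catalan regime `p^x ± q^y = 2^k r^z`, …) — open. [folklore] -/
theorem abcBoundedOmega_of_weightedSzpiroBound (h : WeightedSzpiroBound) (B : ℕ) : AbcBoundedOmega B :=
  abcBoundedOmega_of_szpiroFewBadPrimes (szpiroFewBadPrimes_of_weightedSzpiroBound h (B + 1))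

end Strength

end Summit.ABC.ABC.Cruxes.WeightedSzpiroBound.Disproof
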